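import Mathlib.RingTheory.SimpleModule.WedderburnArtin
import Literature.NumberTheory.Automorphic.QuaternionAlgebraAdelic

/-!
# Quaternion algebras: `x x̄ = nrd(x)` (discharge of `mul_standardInvolution`)

Companion ("proofs") file of `QuaternionAlgebraAdelic` (trunk `AutomorphicAxiomatic`, namespace
`Literature.Automorphic`), proving the named fact

* `mul_standardInvolution_holds : mul_standardInvolution K D` — for a quaternion algebra `D`
  (central simple of dimension `4`) over a field `K` of characteristic `0` and `x ∈ D`,
  `x x̄ = nrd(x) · 1`, where `x̄ = standardInvolution K D x = ½ Tr_{D/K}(x) - x` and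
  `nrd(x) = reducedNorm K D x = ¼ Tr_{D/K}(x x̄)` (Vignéras, LNM 800, Ch. I §1 p. 1–2:
  `t(h) = h + h̄`, `n(h) = h h̄`, "la trace de H/K est T = 2t"; Lemme 1.1).

## Proof

Vignéras defines a quaternion algebra as `{L, θ}` and remarks (I §1 p. 1) that every central
simple algebra of dimension `4` is one; `IsQuaternionAlgebra` is the latter notion, so the proof
has to go through the structure theory:

* `exists_mul_self_eq_of_isQuaternionAlgebra`: every `x ∈ D` satisfies `x² = t x - n` with
  `t, n ∈ K` and `Tr_{D/K}(x) = 2t` (the minimal polynomial `X² - t(h) X + n(h)` and `T = 2t`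
  of I §1 p. 2). By Wedderburn–Artin (Mathlib
  `IsSimpleRing.exists_algEquiv_matrix_divisionRing_finite`) `D ≃ₐ[K] Mₙ(D')` for a division
  algebra `D'`, and `4 = n² · dim_K D'` leaves two cases (cf. I §2 Cor. 2.4):
  - `D ≃ M₂(K)`: Cayley–Hamilton for `2 × 2` matrices and `Tr(L_x) = 2 tr(x)`
    (`exists_mul_self_eq_matrix`; I §1 p. 3);
  - `D ≃ D'` a central division algebra of dimension `4`: for `x ∉ K` the subalgebra `K[x]` is
    a skew field with `4 = [K[x]:K] · dim_{K[x]} D'`, and `[K[x]:K] ≠ 1, 4` (`x ∉ K`; `D'` is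
    not commutative), so `x² ∈ K + K x` (`exists_mul_self_eq_of_not_mem_bot`); the trace is
    computed by writing `x = y + t/2` with `y² ∈ K`, `y ∉ K = Z(D')`: some `a ≠ 0`
    anticommutes with `y`, so `L_{-y} = L_a⁻¹ L_y L_a` and `Tr(L_y) = 0`
    (`leftMulTrace_eq_zero_of_mul_self_eq_algebraMap`, `exists_mul_self_eq_of_divisionRing`).
* `mul_standardInvolution_holds`: then `x̄ = t - x`, `x x̄ = t x - x² = n · 1` and
  `nrd(x) = ¼ Tr(L_{n · 1}) = n`.

## References

* M.-F. Vignéras, *Arithmétique des algèbres de quaternions*, LNM 800 (1980), Ch. I §1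
  (pp. 1–3, Lemme 1.1) and §2 (Cor. 2.4). [VignerasLNM800]
-/

namespace Literature.NumberTheory.Automorphic

/-! ### Proof of `mul_standardInvolution` (Vignéras I §1: `n(h) = h h̄`, `T = 2t`) -/

section MulStandardInvolutionProof

variable {K : Type*} [Field K]

/-- The left-multiplication trace is invariant under `K`-algebra isomorphisms:
`Tr_{B/K}(e x) = Tr_{A/K}(x)` (`L_{e x} = e ∘ L_x ∘ e⁻¹` and Mathlib `LinearMap.trace_conj'`). [folklore] -/
theorem leftMulTrace_algEquiv {A B : Type*} [Ring A] [Algebra K A] [Ring B] [Algebra K B]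
    (e : A ≃ₐ[K] B) (x : A) : leftMulTrace K B (e x) = leftMulTrace K A x := by
  have h : Algebra.lmul K B (e x) = e.toLinearEquiv.conj (Algebra.lmul K A x) := by
    ext y
    simp [LinearEquiv.conj_apply]
  rw [leftMulTrace_apply, leftMulTrace_apply, h, LinearMap.trace_conj']

/-- `Tr_{A/K}(c · 1) = c · dim_K A` for a finite-dimensional `K`-algebra `A` (trace of the
scalar endomorphism; Mathlib `LinearMap.trace_id`). [folklore] -/
theorem leftMulTrace_algebraMap (A : Type*) [Ring A] [Algebra K A] [Module.Finite K A] (c : K) :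
    leftMulTrace K A (algebraMap K A c) = c * Module.finrank K A := by
  have h : Algebra.lmul K A (algebraMap K A c) = c • LinearMap.id := by
    ext y
    simp [Algebra.smul_def]
  rw [leftMulTrace_apply, h, map_smul, LinearMap.trace_id, smul_eq_mul]

/-- In a division algebra over a field of characteristic `0`, an element `y` with `y² ∈ K`
that does not commute with some `b` has `Tr(L_y) = 0`: `a := y b y⁻¹ - b ≠ 0` anticommutes
with `y`, so `L_{-y} = L_a⁻¹ ∘ L_y ∘ L_a` has the same trace as `L_y` (cf. the
anti-commutation argument `t(u) = 0` in Vignéras I §1 p. 3 and §2 proof of Cor. 2.2). [folklore] -/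
theorem leftMulTrace_eq_zero_of_mul_self_eq_algebraMap [CharZero K] {D' : Type*}
    [DivisionRing D'] [Algebra K D'] (y : D') (c : K) (hy : y * y = algebraMap K D' c)
    (b : D') (hb : y * b ≠ b * y) : leftMulTrace K D' y = 0 := by
  have hy0 : y ≠ 0 := by
    rintro rfl
    simp at hb
  set a : D' := y * b * y⁻¹ - b with ha
  have ha0 : a ≠ 0 := by
    intro h0
    apply hb
    have h1 : y * b * y⁻¹ = b := sub_eq_zero.1 h0
    calc y * b = y * b * y⁻¹ * y := (inv_mul_cancel_right₀ hy0 _).symm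
      _ = b * y := by rw [h1]
  have hya : y * a = -(a * y) := by
    have hc : algebraMap K D' c * b * y⁻¹ = b * y := by
      rw [Algebra.commutes, ← hy, mul_assoc, mul_assoc, mul_inv_cancel₀ hy0, mul_one]
    simp only [ha, mul_sub, sub_mul, neg_sub]
    rw [inv_mul_cancel_right₀ hy0, ← mul_assoc, ← mul_assoc, hy, hc]
  have hconj : a⁻¹ * y * a = -y := by
    rw [mul_assoc, hya, mul_neg, ← mul_assoc, inv_mul_cancel₀ ha0, one_mul]
  let e : D' ≃ₗ[K] D' :=
    LinearEquiv.ofLinear (Algebra.lmul K D' a⁻¹) (Algebra.lmul K D' a)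
      (by ext v; simp [ha0]) (by ext v; simp [ha0])
  have hconj' : e.conj (Algebra.lmul K D' y) = Algebra.lmul K D' (-y) := by
    ext v
    simp only [LinearEquiv.conj_apply, LinearMap.comp_apply, LinearEquiv.coe_coe, e,
      LinearEquiv.ofLinear_apply, LinearEquiv.ofLinear_symm_apply]
    simp only [Algebra.coe_lmul_eq_mul, LinearMap.mul_apply', ← hconj, mul_assoc]
  have h1 : leftMulTrace K D' (-y) = leftMulTrace K D' y := by
    rw [leftMulTrace_apply, leftMulTrace_apply, ← hconj', LinearMap.trace_conj']
  rw [map_neg] at h1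
  exact CharZero.neg_eq_self_iff.1 h1

/-- In a central division algebra of dimension `4` over `K`, every non-central element `x`
satisfies a quadratic equation `x² = t x - n` over `K`: `K[x]` is a (skew) subfield with
`4 = [K[x]:K] · dim_{K[x]} D'`, and `[K[x]:K] ≠ 1, 4` since `x ∉ K` and `D'` is not
commutative (Vignéras I §1 p. 1–2: "L'algèbre K(h) engendrée par h sur K est quadratique";
I §2 Cor. 2.5, proof). [cite: VignerasLNM800, Ch. I §1 p. 2] -/
theorem exists_mul_self_eq_of_not_mem_bot {D' : Type*} [DivisionRing D'] [Algebra K D']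
    [Algebra.IsCentral K D'] (h4 : Module.finrank K D' = 4) (x : D')
    (hx : x ∉ (⊥ : Subalgebra K D')) :
    ∃ t n : K, x * x = algebraMap K D' t * x - algebraMap K D' n := by
  haveI : Module.Finite K D' := Module.finite_of_finrank_eq_succ h4
  set F : Subalgebra K D' := Algebra.adjoin K {x} with hFdef
  have hxF : x ∈ F := Algebra.self_mem_adjoin_singleton K x
  letI : DivisionRing F := divisionRingOfFiniteDimensional K F
  have hmul : Module.finrank K F * Module.finrank F D' = 4 := by
    rw [Module.finrank_mul_finrank K F D', h4]
  have hF1 : Module.finrank K F ≠ 1 := fun h1 =>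
    hx (Subalgebra.eq_bot_of_finrank_one h1 ▸ hxF)
  have hF4 : Module.finrank K F ≠ 4 := by
    intro hF4
    have hFtop : F = ⊤ := Algebra.toSubmodule_eq_top.1
      (Submodule.eq_top_of_finrank_eq <| F.finrank_toSubmodule.trans (hF4.trans h4.symm))
    apply hx
    apply Algebra.IsCentral.out (K := K) (D := D')
    rw [Subalgebra.mem_center_iff]
    intro b
    have hb : b ∈ Algebra.adjoin K {x} := by
      rw [← hFdef, hFtop]; exact Algebra.mem_top
    exact (Algebra.commute_of_mem_adjoin_singleton_of_commute hb (Commute.refl x)).eq.symm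
  have hF2 : Module.finrank K F = 2 := by
    have hdvd : Module.finrank K F ∣ 4 := Dvd.intro _ hmul
    have hmem : Module.finrank K F ∈ Nat.divisors 4 := Nat.mem_divisors.2 ⟨hdvd, by norm_num⟩
    rw [show Nat.divisors 4 = {1, 2, 4} from by decide] at hmem
    simp only [Finset.mem_insert, Finset.mem_singleton] at hmem
    omega
  have hli : LinearIndependent K ![(1 : D'), x] := by
    refine LinearIndependent.pair_iff.2 fun s t hst => ?_
    by_contra hne
    have ht : t ≠ 0 := by
      rintro rfl
      refine hne ⟨?_, rfl⟩
      simpa using hst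
    refine hx ?_
    have htx : t • x = -(s • (1 : D')) := eq_neg_of_add_eq_zero_right hst
    have hxst : x = algebraMap K D' (-(t⁻¹ * s)) := by
      calc x = t⁻¹ • (t • x) := by rw [smul_smul, inv_mul_cancel₀ ht, one_smul]
        _ = algebraMap K D' (-(t⁻¹ * s)) := by
          rw [htx, smul_neg, smul_smul, Algebra.algebraMap_eq_smul_one, neg_smul]
    rw [hxst]
    exact Subalgebra.algebraMap_mem _ _
  have hspan : Submodule.span K {(1 : D'), x} = Subalgebra.toSubmodule F := by
    apply Submodule.eq_of_le_of_finrank_eq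
    · rw [Submodule.span_le]
      rintro _ (rfl | rfl)
      · exact F.one_mem
      · exact hxF
    · have h := finrank_span_eq_card hli
      rw [Matrix.range_cons_cons_empty, Fintype.card_fin] at h
      rw [h, Subalgebra.finrank_toSubmodule, hF2]
  have hx2 : x * x ∈ Submodule.span K {(1 : D'), x} := by
    rw [hspan]
    exact F.mul_mem hxF hxF
  obtain ⟨c, d, hcd⟩ := Submodule.mem_span_pair.1 hx2
  refine ⟨d, -c, ?_⟩
  rw [← hcd, Algebra.smul_def, Algebra.smul_def, mul_one, map_neg, sub_neg_eq_add, add_comm]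

/-- **Division case.** In a central division algebra `D'` of dimension `4` over a field `K`
of characteristic `0`, every `x` satisfies `x² = t x - n` with `t, n ∈ K` and
`Tr_{D'/K}(x) = 2t` (Vignéras I §1 p. 2: minimal polynomial `X² - t(h)X + n(h)` and
`T = 2t`). Proof: `x ∈ K` is immediate; otherwise `exists_mul_self_eq_of_not_mem_bot`, and
`y := x - t/2` has `y² ∈ K`, `y ∉ K = Z(D')`, so `Tr(L_y) = 0` by
`leftMulTrace_eq_zero_of_mul_self_eq_algebraMap`. [cite: VignerasLNM800, Ch. I §1 p. 2] -/
theorem exists_mul_self_eq_of_divisionRing [CharZero K] {D' : Type*} [DivisionRing D']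
    [Algebra K D'] [Algebra.IsCentral K D'] (h4 : Module.finrank K D' = 4) (x : D') :
    ∃ t n : K, x * x = algebraMap K D' t * x - algebraMap K D' n ∧
      leftMulTrace K D' x = 2 * t := by
  haveI : Module.Finite K D' := Module.finite_of_finrank_eq_succ h4
  by_cases hx : x ∈ (⊥ : Subalgebra K D')
  · obtain ⟨c, rfl⟩ := Algebra.mem_bot.1 hx
    refine ⟨2 * c, c * c, ?_, ?_⟩
    · rw [← map_mul, ← map_mul, ← map_sub]
      congr 1
      ring
    · rw [leftMulTrace_algebraMap, h4]
      push_cast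
      ring
  · obtain ⟨t, n, hxx⟩ := exists_mul_self_eq_of_not_mem_bot h4 x hx
    refine ⟨t, n, hxx, ?_⟩
    set y : D' := x - algebraMap K D' (t / 2) with hy
    have hxy : x = y + algebraMap K D' (t / 2) := by rw [hy, sub_add_cancel]
    have hyy : y * y = algebraMap K D' (t / 2 * (t / 2) - n) := by
      have hcomm : x * algebraMap K D' (t / 2) = algebraMap K D' (t / 2) * x :=
        (Algebra.commutes _ _).symm
      have ht : algebraMap K D' t = algebraMap K D' (t / 2) + algebraMap K D' (t / 2) := by
        rw [← map_add, add_halves]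
      rw [hy, mul_sub, sub_mul, sub_mul, hcomm, hxx, ht, map_sub, map_mul]
      noncomm_ring
    have hyc : ∃ b, y * b ≠ b * y := by
      by_contra! hall
      apply hx
      have hyc : y ∈ Subalgebra.center K D' := Subalgebra.mem_center_iff.2 fun b => (hall b).symm
      have hyb : y ∈ (⊥ : Subalgebra K D') := Algebra.IsCentral.out hyc
      rw [hxy]
      exact add_mem hyb (Subalgebra.algebraMap_mem _ _)
    obtain ⟨b, hb⟩ := hyc
    have hTy : leftMulTrace K D' y = 0 :=
      leftMulTrace_eq_zero_of_mul_self_eq_algebraMap y _ hyy b hb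
    rw [hxy, map_add, hTy, leftMulTrace_algebraMap, h4, zero_add]
    push_cast
    ring

/-- `Tr_{M₂(K)/K}(x) = 2 · tr(x)`: the left regular representation of `M₂(K)` is two copies of
the standard one (computed in the standard basis `Matrix.stdBasis`; Vignéras I §1 p. 2–3:
`T = 2t` and `t = ` trace on `M(2,K)`). [cite: VignerasLNM800, Ch. I §1 p. 3] -/
theorem leftMulTrace_matrix_fin_two (x : Matrix (Fin 2) (Fin 2) K) :
    leftMulTrace K (Matrix (Fin 2) (Fin 2) K) x = 2 * (x 0 0 + x 1 1) := by
  rw [leftMulTrace_apply,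
    LinearMap.trace_eq_matrix_trace K (Matrix.stdBasis K (Fin 2) (Fin 2)), Matrix.trace]
  simp [LinearMap.toMatrix_apply, Fintype.sum_prod_type, Fin.sum_univ_two, Matrix.mul_apply,
    Matrix.stdBasis]
  ring

/-- Cayley–Hamilton for `2 × 2` matrices: `x² = tr(x) x - det(x)` (Vignéras I §1 p. 3: in
`M(2,K)` the reduced trace and norm are the trace and the determinant). [cite: VignerasLNM800, Ch. I §1 p. 3] -/
theorem matrix_fin_two_mul_self (x : Matrix (Fin 2) (Fin 2) K) :
    x * x = algebraMap K (Matrix (Fin 2) (Fin 2) K) (x 0 0 + x 1 1) * x -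
      algebraMap K (Matrix (Fin 2) (Fin 2) K) (x 0 0 * x 1 1 - x 0 1 * x 1 0) := by
  ext i j
  fin_cases i <;> fin_cases j <;>
    simp [Matrix.mul_apply, Fin.sum_univ_two, Matrix.algebraMap_matrix_apply] <;> ring

/-- **Matrix case.** In `M₂(K)` every `x` satisfies `x² = tr(x) x - det(x)` and
`Tr_{M₂(K)/K}(x) = 2 tr(x)` (Vignéras I §1 p. 3). [cite: VignerasLNM800, Ch. I §1 p. 3] -/
theorem exists_mul_self_eq_matrix (x : Matrix (Fin 2) (Fin 2) K) :
    ∃ t n : K, x * x = algebraMap K _ t * x - algebraMap K _ n ∧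
      leftMulTrace K (Matrix (Fin 2) (Fin 2) K) x = 2 * t :=
  ⟨_, _, matrix_fin_two_mul_self x, leftMulTrace_matrix_fin_two x⟩

/-- The property "`x² = t x - n` with `Tr(L_x) = 2t`" transports along `K`-algebra
isomorphisms (`leftMulTrace_algEquiv`). [folklore] -/
theorem exists_mul_self_eq_of_algEquiv {A B : Type*} [Ring A] [Algebra K A] [Ring B]
    [Algebra K B] (e : A ≃ₐ[K] B)
    (h : ∀ y : B, ∃ t n : K, y * y = algebraMap K B t * y - algebraMap K B n ∧
      leftMulTrace K B y = 2 * t)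
    (x : A) : ∃ t n : K, x * x = algebraMap K A t * x - algebraMap K A n ∧
      leftMulTrace K A x = 2 * t := by
  obtain ⟨t, n, h1, h2⟩ := h (e x)
  refine ⟨t, n, e.injective ?_, ?_⟩
  · simpa using h1
  · rw [← leftMulTrace_algEquiv e x, h2]

/-- **Every element of a quaternion algebra is quadratic.** For a central simple algebra `D`
of dimension `4` over a field `K` of characteristic `0` and `x ∈ D` there are `t, n ∈ K` with
`x² = t x - n` and `Tr_{D/K}(x) = 2t` (Vignéras I §1 p. 1–2: "toute algèbre centrale simple de
dimension 4 sur K est une algèbre de quaternions", minimal polynomial `X² - t(h)X + n(h)`,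
`T = 2t`). Proof: by Wedderburn–Artin (Mathlib
`IsSimpleRing.exists_algEquiv_matrix_divisionRing_finite`) `D ≃ Mₙ(D')` with
`4 = n² dim D'`, so `D ≃ M₂(K)` (`exists_mul_self_eq_matrix`) or `D ≃ D'` is a division
algebra (`exists_mul_self_eq_of_divisionRing`); cf. Vignéras I §2 Cor. 2.4. [cite: VignerasLNM800, Ch. I §1 p. 2 and §2 Cor. 2.4] -/
theorem exists_mul_self_eq_of_isQuaternionAlgebra [CharZero K] {D : Type*} [Ring D]
    [Algebra K D] [IsQuaternionAlgebra K D] (x : D) :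
    ∃ t n : K, x * x = algebraMap K D t * x - algebraMap K D n ∧
      leftMulTrace K D x = 2 * t := by
  haveI := IsQuaternionAlgebra.isSimpleRing' K D
  haveI : IsArtinianRing D := IsArtinianRing.of_finite K D
  obtain ⟨n, hn, D', _, _, _, ⟨e⟩⟩ :=
    IsSimpleRing.exists_algEquiv_matrix_divisionRing_finite K D
  have h4 := IsQuaternionAlgebra.finrank_eq_four (K := K) (D := D)
  have hdim : 4 = n * n * Module.finrank K D' := by
    rw [← h4, e.toLinearEquiv.finrank_eq, Module.finrank_matrix, Fintype.card_fin]
  have hpos : 0 < Module.finrank K D' := Module.finrank_pos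
  have hcases : (n = 1 ∧ Module.finrank K D' = 4) ∨ (n = 2 ∧ Module.finrank K D' = 1) := by
    have hn3 : n < 3 := by
      by_contra! h3
      have : 3 * 3 * 1 ≤ n * n * Module.finrank K D' :=
        Nat.mul_le_mul (Nat.mul_le_mul h3 h3) hpos
      omega
    interval_cases n <;> omega
  rcases hcases with ⟨rfl, h4'⟩ | ⟨rfl, h1'⟩
  · -- `M₁(D') ≃ₐ[K] D'` (Mathlib's `Matrix.uniqueAlgEquiv` fixes other
    -- `Fintype`/`DecidableEq` instances on `Fin 1`, so we spell the isomorphism out).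
    let e₁ : Matrix (Fin 1) (Fin 1) D' ≃ₐ[K] D' :=
      { toFun := fun M => M 0 0
        invFun := fun a => Matrix.of fun _ _ => a
        left_inv := fun M => by
          ext i j
          simp [Fin.fin_one_eq_zero i, Fin.fin_one_eq_zero j]
        right_inv := fun a => rfl
        map_mul' := fun M N => by simp [Matrix.mul_apply]
        map_add' := fun M N => rfl
        commutes' := fun r => by simp [Matrix.algebraMap_matrix_apply] }
    let e' : D ≃ₐ[K] D' := e.trans e₁
    haveI : Algebra.IsCentral K D' := Algebra.IsCentral.of_algEquiv K D D' e'
    exact exists_mul_self_eq_of_algEquiv e' (exists_mul_self_eq_of_divisionRing h4') x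
  · have hbij := Algebra.finrank_eq_one_iff_bijective_algebraMap.1 h1'
    let f : K ≃ₐ[K] D' := AlgEquiv.ofBijective (Algebra.ofId K D') hbij
    let e' : D ≃ₐ[K] Matrix (Fin 2) (Fin 2) K := e.trans f.symm.mapMatrix
    exact exists_mul_self_eq_of_algEquiv e' exists_mul_self_eq_matrix x

end MulStandardInvolutionProof

/-- **Discharge of `mul_standardInvolution`**: `x x̄ = nrd(x) · 1` in a quaternion algebra over
a field of characteristic `0` (Vignéras I §1 p. 1–2: `n(h) = h h̄`, `t(h) = h + h̄`, `T = 2t`;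
Lemme 1.1). From `exists_mul_self_eq_of_isQuaternionAlgebra`: `x̄ = ½ Tr(L_x) - x = t - x`,
`x x̄ = t x - x² = n`, and `nrd(x) = ¼ Tr(L_{n·1}) = n`. [cite: VignerasLNM800, Ch. I §1 Lemme 1.1] -/
theorem mul_standardInvolution_holds (K : Type*) (D : Type*) [Field K] [Ring D] [Algebra K D] :
    mul_standardInvolution K D := by
  intro _ _ x
  obtain ⟨t, n, hxx, hT⟩ := exists_mul_self_eq_of_isQuaternionAlgebra (K := K) x
  have htr : reducedTrace K D x = t := by
    simp [reducedTrace, hT]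
  have hmul : x * standardInvolution K D x = algebraMap K D n := by
    rw [standardInvolution, htr, mul_sub, ← Algebra.commutes, hxx, sub_sub_cancel]
  have hnrd : reducedNorm K D x = n := by
    rw [reducedNorm, hmul, leftMulTrace_algebraMap, IsQuaternionAlgebra.finrank_eq_four]
    push_cast
    field_simp
  rw [hmul, hnrd]

end Literature.NumberTheory.Automorphic
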